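import Summits.PneNP.PneNP.Theorems.PstarTypedSALinearLevel
import Summits.PneNP.PneNP.Theorems.PstarSASDPLevel

/-!
# Towards T21.1c: pair laws of the reweighted Sherali–Adams family factor (biased BGMT Claim 3.4) — cell `pnp-ideate`

FRONTIER range-avoidance ladder, rung F-N3 context (restricted-model lower bound for the mixed Sherali–Adams + SDP
hierarchy on typed `P⋆`, `PstarSASDPLevel.SASDPFeasible`); nothing here bears on `P` vs `NP`.

Ingredients for the SA+SDP leaf (`PstarTypedSASDPLinearLevel`), on top of the T21.1 pipeline:

* the bias-product law `W I y ∅` has product cylinder masses (`cyl_W_empty`), so its singleton / pair pseudo-marginals are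
  `bias v` and `bias v · bias w` (`single_W_empty`, `pair_W_empty`); sets of fewer than four variables dominate no output
  (`dom_eq_empty_of_card_lt`, pure instances read four distinct variables);
* **strict expansion off a pair** (`strictExpandingOff_of_card_le_two`, BGMT Claim 3.4's expansion step in biased form):
  under `(r, 7/4)`-boundary expansion with simple overlaps, every family of `≤ r` outputs is strictly boundary expanding
  off any `T` with `#T ≤ 2` — singletons have four boundary variables, pairs at least six (`six_le_card_bdry_pair`),
  and from three members on `7/4 − 2/#J > 1`;
* the T21.1 size arithmetic as reusable lemmas at any budget `t` with `28t ≤ r` (`law_total_of_budget`,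
  `law_consistent_of_closedAt`) and the closure assembly with the family made EXPLICIT (`saProps_of_closure`, the proof
  of `PstarSAAssembly.saFeasible_of_closure` verbatim — the SDP layer must talk about the same laws);
* `momentMatrix_congr_offDiag`: the moment matrix ignores the diagonal of the pair marginals.
-/

set_option linter.dupNamespace false

open Finset Literature.Computability.Complexity
open Summit.PneNP.PneNP.Theorems.PstarPairwise (rho)
open Summit.PneNP.PneNP.Theorems.PstarSA2Blind (momentMatrix)
open Summit.PneNP.PneNP.Theorems.PstarSALevel (cyl varSet bdry BoundaryExpanding SimpleOverlap)
open Summit.PneNP.PneNP.Theorems.PstarSASDPLevel (BoundaryExpandingQ single pair)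
open Summit.PneNP.PneNP.Theorems.PstarTypedSALinearLevel (card_dom_le strictExpandingOff_empty)

namespace Summit.PneNP.PneNP.Theorems.PstarSAPeeling

variable {n m : ℕ}

/-! ## The bias-product law -/

/-- A `T`-cylinder is the set of assignments equal to its centre off `Tᶜ`. -/
theorem filter_agree_eq_cylOff (T : Finset (Fin n)) (a : Fin n → Bool) :
    univ.filter (fun x : Fin n → Bool => ∀ i ∈ T, x i = a i) = cylOff Tᶜ a := by
  ext β
  simp only [mem_filter, mem_univ, true_and, mem_cylOff, mem_compl, not_not]

/-- **Cylinder masses of the bias-product law are products of biases.** -/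
theorem cyl_W_empty (I : LocalMap 4 n m) (y : Fin m → Bool) (T : Finset (Fin n)) (a : Fin n → Bool) :
    cyl (W I y ∅) T a = ∏ v ∈ T, rho (bias I v) (a v) := by
  unfold PstarSALevel.cyl
  rw [filter_agree_eq_cylOff]
  have h : ∀ β ∈ cylOff Tᶜ a, W I y ∅ β = (∏ v ∈ T, rho (bias I v) (a v)) * ∏ v ∈ Tᶜ, rho (bias I v) (β v) := by
    intro β hβ
    rw [W_empty, ← prod_mul_prod_compl T]
    congr 1
    exact prod_congr rfl fun v hv => by rw [mem_cylOff.1 hβ v (fun hc => (mem_compl.1 hc) hv)]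
  rw [sum_congr rfl h, ← mul_sum, sum_cylOff_prod_rho, mul_one]

/-- The singleton pseudo-marginal of the bias-product law is the bias. -/
theorem single_W_empty (I : LocalMap 4 n m) (y : Fin m → Bool) (v : Fin n) :
    cyl (W I y ∅) {v} (fun _ => true) = bias I v := by
  rw [cyl_W_empty, prod_singleton]
  simp [rho]

/-- The pair pseudo-marginal of the bias-product law is the product of the biases. -/
theorem pair_W_empty (I : LocalMap 4 n m) (y : Fin m → Bool) {v w : Fin n} (hvw : v ≠ w) :
    cyl (W I y ∅) {v, w} (fun _ => true) = bias I v * bias I w := by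
  rw [cyl_W_empty, prod_pair hvw]
  simp [rho]

/-- The biases lie in `[0, 1]`. -/
theorem bias_mem_unitInterval (I : LocalMap 4 n m) (v : Fin n) : 0 ≤ bias I v ∧ bias I v ≤ 1 := by
  unfold bias
  split_ifs
  · norm_num
  · exact ⟨rA_pos.le, rA_lt_one.le⟩

/-! ## Pure instances: four variables per output -/

/-- A pure instance reads four distinct variables per output. -/
theorem card_varSet {I : LocalMap 4 n m} (hI : I.IsPure xorAndPred) (j : Fin m) : (varSet I j).card = 4 := by
  unfold PstarSALevel.varSet
  rw [card_image_of_injective _ (hI.2 j), card_univ, Fintype.card_fin]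

/-- Sets of fewer than four variables dominate no output. -/
theorem dom_eq_empty_of_card_lt {I : LocalMap 4 n m} (hI : I.IsPure xorAndPred) {S : Finset (Fin n)} (hS : S.card < 4) :
    dom I S = ∅ := by
  ext j
  simp only [mem_dom, notMem_empty, iff_false]
  intro h
  have := card_le_card h
  rw [card_varSet hI j] at this
  omega

/-! ## Strict expansion off at most two variables (BGMT Claim 3.4's expansion step) -/

/-- The boundary of a single output is its variable set. -/
theorem bdry_singleton (I : LocalMap 4 n m) (j : Fin m) : bdry I {j} = varSet I j := by
  ext v
  unfold PstarSALevel.bdry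
  rw [mem_filter, filter_singleton]
  by_cases hv : v ∈ varSet I j
  · simp [hv]
  · simp [hv]

/-- A variable of `j` not read by `j'` is a boundary variable of `{j, j'}`. -/
theorem mem_bdry_pair_of_mem_sdiff (I : LocalMap 4 n m) {j j' : Fin m} (hne : j ≠ j') {v : Fin n}
    (hv : v ∈ varSet I j \ varSet I j') : v ∈ bdry I {j, j'} := by
  rw [mem_sdiff] at hv
  unfold PstarSALevel.bdry
  rw [mem_filter, card_eq_one]
  refine ⟨mem_univ _, j, ?_⟩
  ext i
  simp only [mem_filter, mem_insert, mem_singleton]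
  constructor
  · rintro ⟨rfl | rfl, hi⟩
    · rfl
    · exact absurd hi hv.2
  · rintro rfl
    exact ⟨Or.inl rfl, hv.1⟩

/-- **Two outputs with simple overlap have at least six boundary variables.** -/
theorem six_le_card_bdry_pair {I : LocalMap 4 n m} (hI : I.IsPure xorAndPred) (hSO : SimpleOverlap I) {j j' : Fin m}
    (hne : j ≠ j') : 6 ≤ (bdry I {j, j'}).card := by
  have hsub : (varSet I j \ varSet I j') ∪ (varSet I j' \ varSet I j) ⊆ bdry I {j, j'} := by
    intro v hv
    rcases mem_union.1 hv with hv | hv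
    · exact mem_bdry_pair_of_mem_sdiff I hne hv
    · rw [pair_comm]
      exact mem_bdry_pair_of_mem_sdiff I hne.symm hv
  have hdisj : Disjoint (varSet I j \ varSet I j') (varSet I j' \ varSet I j) := disjoint_sdiff_sdiff
  have h1 := card_sdiff_add_card_inter (varSet I j) (varSet I j')
  have h2 := card_sdiff_add_card_inter (varSet I j') (varSet I j)
  rw [card_varSet hI] at h1 h2
  rw [inter_comm] at h2
  have h3 := hSO j j' hne
  have h4 := card_le_card hsub
  rw [card_union_of_disjoint hdisj] at h4
  omega

/-- **Strict expansion off at most two variables.**  On a pure instance with simple overlaps that is `(r, 7/4)`-boundary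
expanding, every family of at most `r` outputs is strictly boundary expanding off any set of at most two variables. -/
theorem strictExpandingOff_of_card_le_two {r : ℕ} {I : LocalMap 4 n m} (hI : I.IsPure xorAndPred) (hSO : SimpleOverlap I)
    (hB : BoundaryExpandingQ 7 4 r I) {T : Finset (Fin n)} (hT : T.card ≤ 2) {E : Finset (Fin m)} (hE : E.card ≤ r) :
    StrictExpandingOff I T E := by
  intro J hJ hne
  have hJr : J.card ≤ r := (card_le_card hJ).trans hE
  have h74 := hB J hJr
  have hsd := le_card_sdiff T (bdry I J)
  have hpos := hne.card_pos
  rcases Nat.lt_or_ge J.card 3 with h3 | h3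
  · rcases Nat.lt_or_ge J.card 2 with h2 | h2
    · -- one output: four boundary variables
      obtain ⟨j, rfl⟩ := card_eq_one.1 (show J.card = 1 by omega)
      rw [bdry_singleton] at hsd ⊢
      rw [card_varSet hI] at hsd
      rw [card_singleton]
      omega
    · -- two outputs: at least six boundary variables
      obtain ⟨j, j', hjj', rfl⟩ := card_eq_two.1 (show J.card = 2 by omega)
      have h6 := six_le_card_bdry_pair hI hSO hjj'
      rw [card_pair hjj']
      omega
  · -- three or more outputs: ratio `7/4` beats the two removed variables
    omega

/-! ## The T21.1 size arithmetic at a general budget -/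

/-- CLOSEDNESS at budget `t`: `5/4`-expansion off `S₁` for non-dominated families within budget `r − 4t` (the conclusion of
`PstarSAClosure.exists_closure` for a set of `≤ t` variables). -/
def ClosedAt (I : LocalMap 4 n m) (r t : ℕ) (S₁ : Finset (Fin n)) : Prop :=
  ∀ M : Finset (Fin m), M.Nonempty → (∀ j ∈ M, ¬ varSet I j ⊆ S₁) → M.card + 4 * t ≤ r → 5 * M.card ≤ 4 * (bdry I M \ S₁).card

/-- Normalisation within budget `34t` when `28t ≤ r`. -/
theorem law_total_of_budget {r t : ℕ} {I : LocalMap 4 n m} (hI : I.IsPure xorAndPred) (hT : PstarTyped.Typed I)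
    (hB : BoundaryExpanding r I) (hr : 28 * t ≤ r) (y : Fin m → Bool) {S' : Finset (Fin n)} (hS' : S'.card ≤ 34 * t) :
    ∑ x, law I y S' x = 1 := by
  rcases Nat.eq_zero_or_pos r with hr0 | hrpos
  · have hS0 : S' = ∅ := card_eq_zero.1 (by omega)
    subst hS0
    refine law_total hI hT y ?_
    rw [dom_empty]
    exact strictExpandingOff_empty I ∅
  · rcases Nat.eq_zero_or_pos t with ht0 | htpos
    · have hS0 : S' = ∅ := card_eq_zero.1 (by omega)
      subst hS0
      refine law_total hI hT y ?_
      rw [dom_empty]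
      exact strictExpandingOff_empty I ∅
    · have hlt : 2 * S'.card < 3 * r := by omega
      exact law_total_of_boundaryExpanding hI hT hB y (card_dom_le hB hlt).1

/-- Lemma 3.2 on closed sets within budget `34t` when `28t ≤ r`. -/
theorem law_consistent_of_closedAt {r t : ℕ} {I : LocalMap 4 n m} (hI : I.IsPure xorAndPred) (hT : PstarTyped.Typed I)
    (hB : BoundaryExpanding r I) (hr : 28 * t ≤ r) (y : Fin m → Bool) {S₁ S₂ : Finset (Fin n)} (hC : ClosedAt I r t S₁)
    (h12 : S₁ ⊆ S₂) (hS₂ : S₂.card ≤ 34 * t) (a : Fin n → Bool) : cyl (law I y S₂) S₁ a = cyl (law I y S₁) S₁ a := by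
  refine law_consistent hI hT y h12 ?_ a
  rcases Nat.eq_zero_or_pos t with ht0 | htpos
  · have hS0 : S₂ = ∅ := card_eq_zero.1 (by omega)
    subst hS0
    rw [dom_empty, empty_sdiff]
    exact strictExpandingOff_empty I S₁
  · intro J hJ hne
    have hlt : 2 * S₂.card < 3 * r := by omega
    obtain ⟨-, hdom3⟩ := card_dom_le hB hlt
    have hJc : J.card ≤ (dom I S₂).card := card_le_card (hJ.trans sdiff_subset)
    have hnd : ∀ j ∈ J, ¬ varSet I j ⊆ S₁ := fun j hj h => (mem_sdiff.1 (hJ hj)).2 (mem_dom.2 h)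
    have h5 := hC J hne hnd (by omega)
    have hpos := hne.card_pos
    omega

/-- **The closure assembly with the family explicit** (the proof of `PstarSAAssembly.saFeasible_of_closure`, verbatim, for
the family `S ↦ P (cl S)` itself rather than its existence). -/
theorem saProps_of_closure {k : ℕ} (I : LocalMap k n m) (y : Fin m → Bool) (t B : ℕ)
    (Closed : Finset (Fin n) → Prop) (cl : Finset (Fin n) → Finset (Fin n)) (P : Finset (Fin n) → (Fin n → Bool) → ℝ)
    (hsub : ∀ S, S ⊆ cl S)
    (hclosed : ∀ S, S.card ≤ t → Closed (cl S))
    (hcard : ∀ S, S.card ≤ t → 2 * (cl S).card ≤ B)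
    (hnonneg : ∀ S x, 0 ≤ P S x)
    (htotal : ∀ S, S.card ≤ B → ∑ x, P S x = 1)
    (hsupp : ∀ S (j : Fin m) x, varSet I j ⊆ S → P S x ≠ 0 → I.eval x j = y j)
    (h32 : ∀ S₁ S₂, Closed S₁ → S₁ ⊆ S₂ → S₂.card ≤ B → ∀ a, cyl (P S₂) S₁ a = cyl (P S₁) S₁ a) :
    (∀ S, S.card ≤ t → (∀ x, 0 ≤ P (cl S) x) ∧ ∑ x, P (cl S) x = 1) ∧
    (∀ S T, T ⊆ S → S.card ≤ t → ∀ a, cyl (P (cl S)) T a = cyl (P (cl T)) T a) ∧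
    (∀ S (j : Fin m), S.card ≤ t → varSet I j ⊆ S → ∀ x, P (cl S) x ≠ 0 → I.eval x j = y j) := by
  refine ⟨fun S hS => ⟨fun x => hnonneg _ x, htotal _ ?_⟩, fun S T hTS hS a => ?_,
    fun S j _ hj x hx => hsupp (cl S) j x (hj.trans (hsub S)) hx⟩
  · have := hcard S hS; omega
  · have hT : T.card ≤ t := (card_le_card hTS).trans hS
    have hB : (cl S ∪ cl T).card ≤ B := by
      have h1 := hcard S hS
      have h2 := hcard T hT
      have := card_union_le (cl S) (cl T)
      omega
    have eS : ∀ b, cyl (P (cl S ∪ cl T)) (cl S) b = cyl (P (cl S)) (cl S) b :=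
      h32 (cl S) (cl S ∪ cl T) (hclosed S hS) subset_union_left hB
    have eT : ∀ b, cyl (P (cl S ∪ cl T)) (cl T) b = cyl (P (cl T)) (cl T) b :=
      h32 (cl T) (cl S ∪ cl T) (hclosed T hT) subset_union_right hB
    have e1 : cyl (P (cl S)) T a = cyl (P (cl S ∪ cl T)) T a :=
      (PstarSAAssembly.cyl_eq_of_subset _ _ T (cl S) (hTS.trans (hsub S)) eS a).symm
    have e2 : cyl (P (cl T)) T a = cyl (P (cl S ∪ cl T)) T a :=
      (PstarSAAssembly.cyl_eq_of_subset _ _ T (cl T) (hsub T) eT a).symm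
    rw [e1, e2]

/-! ## The moment matrix ignores the diagonal of the pair marginals -/

/-- Two pair-marginal functions that agree off the diagonal give the same moment matrix. -/
theorem momentMatrix_congr_offDiag (p : Fin n → ℝ) {P P' : Fin n → Fin n → ℝ} (h : ∀ u v, u ≠ v → P u v = P' u v) :
    momentMatrix p P = momentMatrix p P' := by
  funext a b
  rcases a with _ | u <;> rcases b with _ | v <;> simp only [momentMatrix]
  by_cases huv : u = v
  · rw [if_pos huv, if_pos huv]
  · rw [if_neg huv, if_neg huv, h u v huv]

end Summit.PneNP.PneNP.Theorems.PstarSAPeeling
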